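import Summits.Ventures.HodgeRepro2.T5LocalDegreeBounds

/-!
# T5QuadraticPlaceTrichotomy — every finite place of `K` is SPLIT, INERT or RAMIFIED in a quadratic
`L / K`, in Mathlib's vocabulary, with the local degrees attached

Tier-5 kernel support (N3) — p8, gen 15.  §8(d): uses an L-value-free non-vanishing device: NO.

The record sorts the finite places `v` of `F` by their behaviour in the quadratic CM extension
`E / F`: split (`E ⊗ F_v = F_v × F_v`), inert (`E_v / F_v` unramified quadratic) or ramified.
Mathlib's `Σ_{w ∣ v} e(w/v) f(w/v) = [L : K] = 2` (`Ideal.sum_ramification_inertia`) with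
`1 ≤ #{w ∣ v} ≤ 2` gives the trichotomy:
* `exists_two_or_unique` — either two distinct primes lie over `v`, or exactly one;
* `quadratic_place_trichotomy` — SPLIT: two distinct primes `w ≠ w'` over `v` (each of local degree `1`, by
  `T5SplitPlaceLocalDegree`); INERT: a unique prime `w` over `v` with `e = 1`, `f = 2`; RAMIFIED: a
  unique prime `w` over `v` with `e = 2`, `f = 1`.  In the last two cases `[L_w : K_v] = 2`
  (`T5InertGlobalToLocal`).

Nothing here identifies which places of the datum fall in which class.
-/

namespace Summit.Ventures.HodgeRepro2.T5QuadraticPlaceTrichotomy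

open IsDedekindDomain HeightOneSpectrum NumberField

variable {K : Type*} [Field K] [NumberField K] (v : HeightOneSpectrum (RingOfIntegers K))
variable {L : Type*} [Field L] [NumberField L] [Algebra K L]

omit [NumberField K] [NumberField L] in
/-- A prime of `L` lying over the finite place `v` is non-zero. -/
theorem ne_bot_of_mem_primesOver {P : Ideal (𝓞 L)} (hP : P ∈ v.asIdeal.primesOver (𝓞 L)) :
    P ≠ ⊥ := by
  rintro rfl
  apply v.ne_bot
  rw [hP.2.over]
  exact Ideal.comap_bot_of_injective _ (FaithfulSMul.algebraMap_injective (𝓞 K) (𝓞 L))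

/-- The primes of `L` over `v` form a non-empty finite set. -/
theorem primesOverFinset_nonempty :
    (IsDedekindDomain.primesOverFinset v.asIdeal (𝓞 L)).Nonempty := by
  haveI : v.asIdeal.IsMaximal := v.isMaximal
  obtain ⟨⟨P, hP⟩⟩ := Ideal.nonempty_primesOver (S := 𝓞 L) v.asIdeal
  exact ⟨P, (IsDedekindDomain.mem_primesOverFinset_iff v.ne_bot _).2 hP⟩

/-- In a quadratic `L / K` at most two primes lie over `v`. -/
theorem card_primesOverFinset_le_two (h2 : Module.finrank K L = 2) :
    (IsDedekindDomain.primesOverFinset v.asIdeal (𝓞 L)).card ≤ 2 := by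
  haveI : v.asIdeal.IsMaximal := v.isMaximal
  haveI : NoZeroSMulDivisors (𝓞 K) (𝓞 L) := ⟨fun {c x} h => by
    rw [Algebra.smul_def] at h
    rcases mul_eq_zero.1 h with h | h
    · exact Or.inl ((map_eq_zero_iff _ (FaithfulSMul.algebraMap_injective (𝓞 K) (𝓞 L))).1 h)
    · exact Or.inr h⟩
  have := Ideal.card_primesOverFinset_le_finrank (𝓞 L) K L (p := v.asIdeal) v.ne_bot
  omega

/-- Either two distinct places of `L` lie over `v`, or exactly one. -/
theorem exists_two_or_unique (h2 : Module.finrank K L = 2) :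
    (∃ w w' : HeightOneSpectrum (𝓞 L), w ≠ w' ∧ w.asIdeal.LiesOver v.asIdeal ∧
      w'.asIdeal.LiesOver v.asIdeal) ∨
    (∃ w : HeightOneSpectrum (𝓞 L), w.asIdeal.LiesOver v.asIdeal ∧
      ∀ w' : HeightOneSpectrum (𝓞 L), w'.asIdeal.LiesOver v.asIdeal → w' = w) := by
  classical
  haveI : v.asIdeal.IsMaximal := v.isMaximal
  have hle := card_primesOverFinset_le_two v h2
  have hpos := (primesOverFinset_nonempty (L := L) v).card_pos
  rcases (show (IsDedekindDomain.primesOverFinset v.asIdeal (𝓞 L)).card = 1 ∨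
      (IsDedekindDomain.primesOverFinset v.asIdeal (𝓞 L)).card = 2 by omega) with h1 | hc2
  · right
    obtain ⟨P, hPeq⟩ := Finset.card_eq_one.1 h1
    have hP : P ∈ v.asIdeal.primesOver (𝓞 L) :=
      (IsDedekindDomain.mem_primesOverFinset_iff v.ne_bot _).1 (by rw [hPeq]; exact Finset.mem_singleton_self P)
    refine ⟨⟨P, hP.1, ne_bot_of_mem_primesOver v hP⟩, hP.2, fun w' hw' => ?_⟩
    have hmem : w'.asIdeal ∈ IsDedekindDomain.primesOverFinset v.asIdeal (𝓞 L) :=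
      (IsDedekindDomain.mem_primesOverFinset_iff v.ne_bot _).2 ⟨w'.isPrime, hw'⟩
    rw [hPeq, Finset.mem_singleton] at hmem
    exact HeightOneSpectrum.ext hmem
  · left
    obtain ⟨P, P', hne, hPeq⟩ := Finset.card_eq_two.1 hc2
    have hP : P ∈ v.asIdeal.primesOver (𝓞 L) :=
      (IsDedekindDomain.mem_primesOverFinset_iff v.ne_bot _).1
        (by rw [hPeq]; exact Finset.mem_insert_self P {P'})
    have hP' : P' ∈ v.asIdeal.primesOver (𝓞 L) :=
      (IsDedekindDomain.mem_primesOverFinset_iff v.ne_bot _).1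
        (by rw [hPeq]; exact Finset.mem_insert_of_mem (Finset.mem_singleton_self P'))
    exact ⟨⟨P, hP.1, ne_bot_of_mem_primesOver v hP⟩, ⟨P', hP'.1, ne_bot_of_mem_primesOver v hP'⟩,
      fun h => hne (congrArg HeightOneSpectrum.asIdeal h), hP.2, hP'.2⟩

/-- If `w` is the ONLY prime over `v` in the quadratic `L / K` then `e(w/v) f(w/v) = 2`. -/
theorem ramificationIdx'_mul_inertiaDeg'_eq_two_of_unique (h2 : Module.finrank K L = 2)
    (w : HeightOneSpectrum (𝓞 L)) [w.asIdeal.LiesOver v.asIdeal]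
    (huniq : ∀ w' : HeightOneSpectrum (𝓞 L), w'.asIdeal.LiesOver v.asIdeal → w' = w) :
    v.asIdeal.ramificationIdx' w.asIdeal * v.asIdeal.inertiaDeg' w.asIdeal = 2 := by
  classical
  haveI : v.asIdeal.IsMaximal := v.isMaximal
  have hS : IsDedekindDomain.primesOverFinset v.asIdeal (𝓞 L) = {w.asIdeal} := by
    ext P
    rw [IsDedekindDomain.mem_primesOverFinset_iff v.ne_bot, Finset.mem_singleton]
    constructor
    · intro hP
      haveI := hP.2
      exact congrArg HeightOneSpectrum.asIdeal (huniq ⟨P, hP.1, ne_bot_of_mem_primesOver v hP⟩ hP.2)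
    · rintro rfl
      exact ⟨w.isPrime, inferInstance⟩
  have h := Ideal.sum_ramification_inertia (𝓞 L) K L (p := v.asIdeal) v.ne_bot
  rw [hS, Finset.sum_singleton, h2] at h
  exact h

/-- THE TRICHOTOMY. In a quadratic `L / K` every finite place `v` of `K` is
SPLIT (two distinct primes over it), INERT (a unique prime with `e = 1`, `f = 2`) or RAMIFIED (a
unique prime with `e = 2`, `f = 1`). -/
theorem quadratic_place_trichotomy (h2 : Module.finrank K L = 2) :
    (∃ w w' : HeightOneSpectrum (𝓞 L), w ≠ w' ∧ w.asIdeal.LiesOver v.asIdeal ∧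
      w'.asIdeal.LiesOver v.asIdeal) ∨
    (∃ w : HeightOneSpectrum (𝓞 L), w.asIdeal.LiesOver v.asIdeal ∧
      (∀ w' : HeightOneSpectrum (𝓞 L), w'.asIdeal.LiesOver v.asIdeal → w' = w) ∧
      v.asIdeal.ramificationIdx' w.asIdeal = 1 ∧ v.asIdeal.inertiaDeg' w.asIdeal = 2) ∨
    (∃ w : HeightOneSpectrum (𝓞 L), w.asIdeal.LiesOver v.asIdeal ∧
      (∀ w' : HeightOneSpectrum (𝓞 L), w'.asIdeal.LiesOver v.asIdeal → w' = w) ∧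
      v.asIdeal.ramificationIdx' w.asIdeal = 2 ∧ v.asIdeal.inertiaDeg' w.asIdeal = 1) := by
  rcases exists_two_or_unique v h2 with h | ⟨w, hw, huniq⟩
  · exact Or.inl h
  · haveI := hw
    have hef := ramificationIdx'_mul_inertiaDeg'_eq_two_of_unique v h2 w huniq
    have hloc : Module.finrank (v.adicCompletion K) (w.adicCompletion L) = 2 := by
      rw [T5InertGlobalToLocal.finrank_adicCompletion_eq_mul v w, hef]
    rcases T5LocalDegreeBounds.ramificationIdx'_inertiaDeg'_of_quadratic v w hloc with he | he
    · exact Or.inr (Or.inl ⟨w, hw, huniq, he.1, he.2⟩)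
    · exact Or.inr (Or.inr ⟨w, hw, huniq, he.1, he.2⟩)

/-- At a non-split place of a quadratic extension (a unique prime over `v`) the local degree is
`2`. -/
theorem finrank_adicCompletion_eq_two_of_unique (h2 : Module.finrank K L = 2)
    (w : HeightOneSpectrum (𝓞 L)) [w.asIdeal.LiesOver v.asIdeal]
    (huniq : ∀ w' : HeightOneSpectrum (𝓞 L), w'.asIdeal.LiesOver v.asIdeal → w' = w) :
    Module.finrank (v.adicCompletion K) (w.adicCompletion L) = 2 := by
  rw [T5InertGlobalToLocal.finrank_adicCompletion_eq_mul v w]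
  exact ramificationIdx'_mul_inertiaDeg'_eq_two_of_unique v h2 w huniq

end Summit.Ventures.HodgeRepro2.T5QuadraticPlaceTrichotomy
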